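import Summits.QuantumAdvantage.QuantumAdvantage.Theorems.LinnikCubicClassGroupsDegreeOnePrimesEscapeDeuringSmoothedCoreAll
import Summits.QuantumAdvantage.QuantumAdvantage.Theorems.LinnikCubicClassGroupsDegreeOnePrimesEscapeDeuringSmoothed
import HarnessLib

/-!
# The Deuring-twisted smoothed explicit formula of a cyclic `N|E`: the dichotomy, for EVERY base field `E`

Topic `Summits/QuantumAdvantage/QuantumAdvantage/Theorems`, cell B2b-1 (linnik-cubic), PART A (gen 13); helper
toward the crux `DegreeOnePrimesEscape` (stmt-QuantumAdvantage-11543) — the LMO chain for conjugacy classes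
WITHOUT the restriction `1 < [E:ℚ]`.  HONEST FRAMING: the value is a THEOREM — NOT summit progress.

`deuringSum_dichotomy_dh_all` is `deuringSum_dichotomy_dh` (`…DeuringSmoothed.lean`, gen 12) verbatim with
`deuringSum_core_all` in place of `deuringSum_core`.
References: [LagariasMontgomeryOdlyzko1979, §7]; [ThornerZaman2019, Thm. 1.4, §5]; [Weiss1983].
-/

noncomputable section

open Complex Real MeasureTheory Set Filter Topology NumberField NumberField.InfinitePlace IsDedekindDomain
open scoped NumberField nonZeroDivisors

namespace Summit.QuantumAdvantage.QuantumAdvantage.Theorems.DegreeOnePrimesEscape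

open Literature.NumberTheory.LFunctions Literature.NumberTheory.LFunctions.NumberField
  Literature.NumberTheory.LFunctions.EntireEF Literature.NumberTheory.LFunctions.TZWeight
  Literature.NumberTheory.LFunctions.AbelianDensity

/-! ### The main theorem -/

set_option maxHeartbeats 6400000 in
/-- **The Deuring-twisted smoothed explicit formula of a cyclic `N|E`, two-sided, with the exceptional zero
of `ζ_N` and Deuring–Heilbronn, for EVERY base field `E`** (`deuringSum_dichotomy_dh` without `1 < [E:ℚ]`;
see the module docstring). [cite: LagariasMontgomeryOdlyzko1979, §7]
[cite: ThornerZaman2019, Theorem 1.4] -/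
theorem deuringSum_dichotomy_dh_all (n₀ : ℕ) (hn₀ : 1 < n₀) {b D a : ℝ} (hb : 0 < b) (hD : 0 < D)
    (ha : 1 ≤ a) {η : ℝ} (hη : 0 < η)
    (hDH : ∃ C : ℝ, 0 < C ∧ ∀ (K : Type) [Field K] [NumberField K] (χ₁ : ClassGroup (𝓞 K) →* ℂˣ),
      χ₁ * χ₁ = 1 → ∀ β₁ : ℝ, 0 < β₁ → β₁ < 1 → classGroupLFunction K χ₁ β₁ = 0 →
      ∀ (χ : ClassGroup (𝓞 K) →* ℂˣ) (ρ : ℂ), classGroupLFunction K χ ρ = 0 → 1 / 2 ≤ ρ.re → ρ ≠ 1 →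
        ρ ≠ β₁ →
        Real.log (1 / (C * (Real.log ((NumberField.discr K).natAbs : ℝ) +
            Module.finrank ℚ K * (Real.log (|ρ.im| + 2) + 1)) * (1 - β₁))) /
          (C * (Real.log ((NumberField.discr K).natAbs : ℝ) +
            Module.finrank ℚ K * (Real.log (|ρ.im| + 2) + 1))) ≤ 1 - ρ.re) :
    ∃ ν a₁ c : ℝ, 0 < ν ∧ ν ≤ 1 / 64 ∧ 1 ≤ a₁ ∧ 0 < c ∧ c ≤ 1 / (8 * ((n₀ : ℝ) ^ 2 + 1)) ∧
    ∀ (E N : Type) [Field E] [NumberField E] [Field N] [NumberField N] [Algebra E N],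
      Module.finrank ℚ N = n₀ →
      -- the log-free density bound for the class-group family of `N`
      (∀ (T : ℝ), 1 ≤ T → ∀ u : AddChar (Additive (ClassGroup (𝓞 N))) ℂ → Finset ℂ,
        (∀ ψ, ∀ ρ ∈ u ψ, famF N ψ ρ = 0 ∧ 1 / 4 ≤ ρ.re ∧ ρ.re < 1 ∧ |ρ.im| ≤ T) →
        ∀ α : ℝ, α ≤ 1 →
          ∑ ψ, ∑ ρ ∈ u ψ with α ≤ ρ.re, (famMult N ψ ρ : ℝ) ≤
            D * Real.exp (b * (a * Real.log (ThornerZaman.condQn N) + Real.log (T + 4))) ^ (1 - α)) →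
      -- the Hecke data of the cyclic extension
      ∀ (m : ℕ), 1 ≤ m → Module.finrank ℚ N = Module.finrank ℚ E * m →
      ∀ (𝔣 : ℕ → Ideal (𝓞 E)) (χ : ℕ → HeightOneSpectrum (𝓞 E) → ℂ)
        (p : ℕ → Finset {w : InfinitePlace E // w.IsReal}) (L L' : ℕ → ℂ → ℂ),
      (∀ j, 𝔣 j ≠ ⊥ ∧ IsRayClassCharacter (𝔣 j) (χ j) ∧ IsPrimitive (𝔣 j) (χ j) ∧ IsSignType (𝔣 j) (χ j) (p j)) →
      (∀ j ∈ Finset.Ico 1 m, ∃ v : HeightOneSpectrum (𝓞 E), ¬ 𝔣 j ≤ v.asIdeal ∧ χ j v ≠ 1) →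
      (∀ j ∈ Finset.Ico 1 m, Differentiable ℂ (L j) ∧ ∀ s : ℂ, 1 < s.re → L j s = rayClassLSeries (𝔣 j) (χ j) s) →
      (∀ j ∈ Finset.Ico 1 m, Differentiable ℂ (L' j) ∧
        ∀ s : ℂ, 1 < s.re → L' j s = rayClassLSeries (𝔣 j) (star (χ j)) s) →
      (∀ ρ : ℂ, analyticOrderNatAt (dedekindZeta₁ N) ρ =
        analyticOrderNatAt (dedekindZeta₁ E) ρ + ∑ j ∈ Finset.Ico 1 m, analyticOrderNatAt (L j) ρ) →
      𝔣 0 = ⊤ → (∀ v, χ 0 v = 1) →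
      (∀ j ∈ Finset.Ico 1 m, |(NumberField.discr E : ℝ)| * (Ideal.absNorm (𝔣 j) : ℝ) ≤ (NumberField.discr N).natAbs) →
      ((NumberField.discr E).natAbs : ℝ) ≤ (NumberField.discr N).natAbs →
      (∀ (cc : ℂ), ‖cc‖ ≤ 1 → ∀ x : ℝ, ThornerZaman.condQn N ^ a₁ ≤ x →
          (¬ ∃ β₁ : ℝ, dedekindZeta₁ N β₁ = 0 ∧
            1 - c / (Real.log ((NumberField.discr N).natAbs : ℝ) + Real.log 4) < β₁ ∧ β₁ < 1) →
          ‖∑ j ∈ Finset.range m, cc ^ j * coefFordK (rcCoef (𝔣 j) (χ j)) (tzTest (Real.log x) (x ^ (-ν))) 0 -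
              fordLaplace (tzTest (Real.log x) (x ^ (-ν))) (-1)‖ ≤ η * x) ∧
      (∀ β₁ : ℝ, dedekindZeta₁ N β₁ = 0 →
          1 - c / (Real.log ((NumberField.discr N).natAbs : ℝ) + Real.log 4) < β₁ → β₁ < 1 →
        ∃ j₀ : ℕ, j₀ < m ∧
          ((j₀ = 0 ∧ analyticOrderNatAt (dedekindZeta₁ E) β₁ = 1) ∨ (0 < j₀ ∧ analyticOrderNatAt (L j₀) β₁ = 1)) ∧
          ∀ (cc : ℂ), ‖cc‖ ≤ 1 → ∀ x : ℝ, ThornerZaman.condQn N ^ a₁ ≤ x →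
            ‖∑ j ∈ Finset.range m, cc ^ j * coefFordK (rcCoef (𝔣 j) (χ j)) (tzTest (Real.log x) (x ^ (-ν))) 0 -
                fordLaplace (tzTest (Real.log x) (x ^ (-ν))) (-1) +
                cc ^ j₀ * fordLaplace (tzTest (Real.log x) (x ^ (-ν))) (-(β₁ : ℂ))‖ ≤
              η * x * min 1 ((1 - β₁) * Real.log x)) := by
  classical
  obtain ⟨ν, a₀, A₀, hν0, hν64, ha₀1, hA₀, hZ⟩ := fam_zeroSum_le_local_zfr n₀ hn₀ hb hD ha
  obtain ⟨c₀, hc₀, hpack⟩ := exists_exceptionalZero_const n₀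
  obtain ⟨Al, hAl0, hAl⟩ := exists_norm_logDeriv_classGroupLFunction_left_le
  obtain ⟨Cr, hCr0, hCr⟩ := exists_norm_logDeriv_continuation_left_le
  obtain ⟨M, hM1, hM⟩ := TZWeight.exists_smoothTransition_deriv_bound
  have hlC := leftLineConst_nonneg
  obtain ⟨C, hC, hDH'⟩ := hDH
  obtain ⟨c₁, hc₁, hc₁1, heff⟩ := Residue.one_sub_realZero_ge_condQn_rpow n₀ hn₀
  have hn2 : (2 : ℝ) ≤ n₀ := by exact_mod_cast hn₀
  have hn0 : (0 : ℝ) < n₀ := by linarith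
  set c : ℝ := min c₀ (1 / (8 * ((n₀ : ℝ) ^ 2 + 1))) with hcdef
  have hc : 0 < c := lt_min hc₀ (by positivity)
  have hcc₀ : c ≤ c₀ := min_le_left _ _
  have hcn : c ≤ 1 / (8 * ((n₀ : ℝ) ^ 2 + 1)) := min_le_right _ _
  have hM0 : 0 ≤ M := by linarith
  set CJ : ℝ := 8 * leftLineConst * (max Al Cr) * ((n₀ : ℝ) + 1) * M with hCJ
  have hAC0 : 0 < max Al Cr := lt_max_of_lt_left hAl0
  have hCJ0 : 0 ≤ CJ := by positivity
  -- the family of `m ≤ n₀` characters multiplies the zero-sum constant by `n₀`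
  set A₁ : ℝ := n₀ * A₀ with hA₁
  have hA₁0 : 0 < A₁ := by positivity
  set cu : ℝ := min 1 (min (1 / (6 * C * n₀)) (η / (32 * A₁ * C ^ 2 * n₀ ^ 2))) with hcu
  have hcu0 : 0 < cu := lt_min one_pos (lt_min (by positivity) (by positivity))
  have hcu1 : cu ≤ 1 := min_le_left _ _
  have hcuC : cu ≤ 1 / (6 * C * n₀) := (min_le_right _ _).trans (min_le_left _ _)
  have hcuA : cu ≤ η / (32 * A₁ * C ^ 2 * n₀ ^ 2) := (min_le_right _ _).trans (min_le_right _ _)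
  set Λ : ℝ := max 1 (Real.log (8 * A₁ / (η * cu))) with hΛ
  have hΛ0 : 0 ≤ Λ := le_trans zero_le_one (le_max_left _ _)
  set ΛJ : ℝ := (2 + max 0 (Real.log (4 * (A₁ + 1152 + CJ) / (η * c₁)))) / ν with hΛJ
  set Λ₁ : ℝ := 8 * a * C * n₀ with hΛ₁
  set Λ₂ : ℝ := 32 * C * n₀ + 16 * C * n₀ * max 0 (Real.log (1 / (2 * C * n₀ * c₁))) with hΛ₂
  set Λ₃ : ℝ := 8 * (2 + max 0 (Real.log (8 * A₁ / (η * c₁)))) ^ 2 with hΛ₃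
  set a₁ : ℝ := max (max (max a₀ 32) (max (4 * a * Λ / c) (2 * Λ ^ 2 / c)))
    (max (max ΛJ Λ₁) (max Λ₂ Λ₃)) with ha₁
  have ha₁a₀ : a₀ ≤ a₁ := le_trans (le_trans (le_max_left _ _) (le_max_left _ _)) (le_max_left _ _)
  have ha₁32 : (32 : ℝ) ≤ a₁ := le_trans (le_trans (le_max_right _ _) (le_max_left _ _)) (le_max_left _ _)
  have ha₁i : 4 * a * Λ / c ≤ a₁ := le_trans (le_trans (le_max_left _ _) (le_max_right _ _)) (le_max_left _ _)
  have ha₁i' : 2 * Λ ^ 2 / c ≤ a₁ := le_trans (le_trans (le_max_right _ _) (le_max_right _ _)) (le_max_left _ _)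
  have ha₁J : ΛJ ≤ a₁ := le_trans (le_trans (le_max_left _ _) (le_max_left _ _)) (le_max_right _ _)
  have ha₁1' : Λ₁ ≤ a₁ := le_trans (le_trans (le_max_right _ _) (le_max_left _ _)) (le_max_right _ _)
  have ha₁2' : Λ₂ ≤ a₁ := le_trans (le_trans (le_max_left _ _) (le_max_right _ _)) (le_max_right _ _)
  have ha₁3' : Λ₃ ≤ a₁ := le_trans (le_trans (le_max_right _ _) (le_max_right _ _)) (le_max_right _ _)
  have ha₁1 : (1 : ℝ) ≤ a₁ := by linarith
  refine ⟨ν, a₁, c, hν0, hν64, ha₁1, hc, hcn, ?_⟩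
  intro E N _ _ _ _ _ hNn hdens m hm1 hdeg 𝔣 χ p L L' hdata hnt hL hL' hord h𝔣0 hχ0 hcond hdE
  -- sizes
  have hN : 1 < Module.finrank ℚ N := by rw [hNn]; exact hn₀
  set Q : ℝ := ThornerZaman.condQn N with hQ
  have hQ12 : (12 : ℝ) ≤ Q := ThornerZaman.twelve_le_condQn (K := N) hN
  have hQ1 : (1 : ℝ) < Q := by linarith
  have hQ0 : (0 : ℝ) < Q := by linarith
  have hlogQ : 2 ≤ Real.log Q := two_lt_log_twelve.le.trans (Real.log_le_log (by norm_num) hQ12)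
  have hlogQ0 : 0 < Real.log Q := by linarith
  have hQm2 : Q ^ (-(2 : ℝ)) ≤ 1 := Real.rpow_le_one_of_one_le_of_nonpos hQ1.le (by norm_num)
  have hQm2' : 0 < Q ^ (-(2 : ℝ)) := Real.rpow_pos_of_pos hQ0 _
  have hQexp2 : Q ^ (-(2 : ℝ)) = Real.exp (-(2 * Real.log Q)) := by
    rw [Real.rpow_def_of_pos hQ0]; ring_nf
  have hmn₀ : (m : ℝ) ≤ n₀ := by
    have : m ≤ n₀ := by
      rw [← hNn, hdeg]; exact Nat.le_mul_of_pos_left m Module.finrank_pos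
    exact_mod_cast this
  have hnEn₀ : (Module.finrank ℚ E : ℝ) ≤ n₀ := by
    have : Module.finrank ℚ E ≤ n₀ := by rw [← hNn, hdeg]; exact Nat.le_mul_of_pos_right _ hm1
    exact_mod_cast this
  -- the Landau–Page package of `N`, read for `ζ₁_N = F_0`
  obtain ⟨hLPreal, hLPuniq, hLPsimple⟩ := hpack N hNn
  have hpack_c : ∀ (χ' : ClassGroup (𝓞 N) →* ℂˣ) (ρ : ℂ),
      (((χ' = 1 → dedekindZeta₁ N ρ = 0) ∧ (χ' ≠ 1 → classGroupLFunction₀ N χ' ρ = 0)) ∧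
        1 - c / (Real.log ((NumberField.discr N).natAbs : ℝ) + Real.log (|ρ.im| + 4)) < ρ.re) →
        ρ.im = 0 ∧ χ' * χ' = 1 :=
    fun χ' ρ h ↦ hLPreal χ' ρ ⟨h.1, lpRegion_mono hcc₀ h.2⟩
  have hexcZ : ∀ ρ, dedekindZeta₁ N ρ = 0 → excRegion c N ρ →
      (((1 : ClassGroup (𝓞 N) →* ℂˣ) = 1 → dedekindZeta₁ N ρ = 0) ∧
        ((1 : ClassGroup (𝓞 N) →* ℂˣ) ≠ 1 → classGroupLFunction₀ N 1 ρ = 0)) ∧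
        1 - c₀ / (Real.log ((NumberField.discr N).natAbs : ℝ) + Real.log (|ρ.im| + 4)) < ρ.re := fun ρ h0 hexc ↦
    ⟨⟨fun _ ↦ h0, fun h ↦ absurd rfl h⟩, lpRegion_mono hcc₀ (by rw [hexc.1, abs_zero, zero_add]; exact hexc.2)⟩
  have hzfr_c : ∀ (x : ℝ) (ψ : AddChar (Additive (ClassGroup (𝓞 N))) ℂ) (ρ : ℂ), famF N ψ ρ = 0 →
      1 / 4 ≤ ρ.re → ρ.re < 1 → |ρ.im| ≤ x → ¬ excRegion c N ρ →
        ρ.re ≤ 1 - c / (a * Real.log (ThornerZaman.condQn N) + Real.log (|ρ.im| + 4)) := by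
    intro x ψ ρ h0 _ _ _ hexc
    have h1 := re_le_of_not_excRegion hpack_c ψ h0 hexc
    have hdQ : Real.log ((NumberField.discr N).natAbs : ℝ) ≤ a * Real.log Q := by
      have hd0 : (0 : ℝ) < ((NumberField.discr N).natAbs : ℝ) := by
        exact_mod_cast Nat.pos_of_ne_zero (Int.natAbs_ne_zero.2 (NumberField.discr_ne_zero N))
      have h2 := Real.log_le_log hd0 (natAbs_discr_le_condQn N)
      rw [← hQ] at h2; nlinarith
    have hlog4 : 0 < Real.log (|ρ.im| + 4) := Real.log_pos (by linarith [abs_nonneg ρ.im])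
    have hlogd : 0 ≤ Real.log ((NumberField.discr N).natAbs : ℝ) := Real.log_natCast_nonneg _
    have : c / (a * Real.log Q + Real.log (|ρ.im| + 4)) ≤
        c / (Real.log ((NumberField.discr N).natAbs : ℝ) + Real.log (|ρ.im| + 4)) :=
      div_le_div_of_nonneg_left hc.le (by linarith) (by linarith)
    rw [← hQ]; linarith
  -- THE CORE ESTIMATE (`deuringSum_core`)
  have hCJAl : 8 * leftLineConst * Al * (n₀ + 1) * M ≤ CJ := by
    rw [hCJ]
    have h1 : 8 * leftLineConst * Al ≤ 8 * leftLineConst * max Al Cr :=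
      mul_le_mul_of_nonneg_left (le_max_left _ _) (by positivity)
    exact mul_le_mul_of_nonneg_right (mul_le_mul_of_nonneg_right h1 (by positivity)) hM0
  have hCJCr : 8 * leftLineConst * Cr * (n₀ + 1) * M ≤ CJ := by
    rw [hCJ]
    have h1 : 8 * leftLineConst * Cr ≤ 8 * leftLineConst * max Al Cr :=
      mul_le_mul_of_nonneg_left (le_max_right _ _) (by positivity)
    exact mul_le_mul_of_nonneg_right (mul_le_mul_of_nonneg_right h1 (by positivity)) hM0
  have ha₁J' : (2 + max 0 (Real.log (4 * (n₀ * A₀ + 1152 + CJ) / (η * c₁)))) / ν ≤ a₁ := by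
    rw [← hA₁, ← hΛJ]; exact ha₁J
  have hcore := deuringSum_core_all n₀ hn₀ (b := b) (D := D) (a := a) hη hν0 hν64 hA₀ (hZ c) hc₁ hAl0 hAl hCr0 hCr hM
    hCJ0 hCJAl hCJCr ha₁a₀ ha₁32 ha₁J' E N hNn hdens m hm1 𝔣 χ p L L' hdata hnt hL hL' hord h𝔣0 hχ0 hcond hdE
    hnEn₀ hmn₀
  rw [← hQ, ← hA₁] at hcore
  -- THE DICHOTOMY
  refine ⟨fun cc hcc x hx hnoexc ↦ ?_, fun β₁ hζβ hβwin hβ1 ↦ ?_⟩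
  · -- (A) no exceptional zero of `ζ₁_N`
    have hex : ¬ ∃ ρ : ℂ, dedekindZeta₁ N ρ = 0 ∧ 0 < ρ.re ∧ ρ.re < 1 ∧ excRegion c N ρ := by
      rintro ⟨ρ, h0, h1, h2, hexc⟩
      obtain ⟨him, -⟩ := hLPreal 1 ρ (hexcZ ρ h0 hexc)
      have hρ : ρ = (ρ.re : ℂ) := by apply Complex.ext <;> simp [him]
      exact hnoexc ⟨ρ.re, by rw [← hρ]; exact h0, hexc.2, h2⟩
    have hx0 : 0 < x := by
      have : Q ^ (1 : ℝ) ≤ Q ^ a₁ := Real.rpow_le_rpow_of_exponent_le hQ1.le ha₁1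
      rw [Real.rpow_one] at this; linarith
    set Lx : ℝ := Real.log x with hLx
    have hLQ : a₁ * Real.log Q ≤ Lx := by
      have := Real.log_le_log (by positivity) hx
      rwa [Real.log_rpow (by linarith)] at this
    have hL2a : 2 * a₁ ≤ Lx := by nlinarith
    have hL0 : 0 < Lx := by linarith
    have key := hcore x hx cc hcc (fun _ ↦ ∅) (fun ρ hρ ↦ by simp at hρ) (fun j _ ρ hρ ↦ by simp at hρ)
      (fun ρ h0 h1 h2 hexc ↦ absurd ⟨ρ, h0, h1, h2, hexc⟩ hex) c hc (hzfr_c x)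
    simp only [Finset.sum_empty, mul_zero, Finset.sum_const_zero, add_zero] at key
    have heΛ : Real.exp (-Λ) ≤ η * cu / (8 * A₁) := by
      refine exp_neg_le_of_neg_log_le (by positivity) ?_
      rw [← Real.log_inv, inv_div]; exact le_max_right _ _
    have hzs := zeroSum_main_small (η := η * cu) hc ha hA₁0 hΛ0 hlogQ0 hL0 hLQ hL2a ha₁i ha₁i' heΛ
    have h1 : x * (A₁ * (Real.exp (-(c * Lx / (4 * a * Real.log Q))) + Real.exp (-Real.sqrt (c * Lx / 4)))) ≤
        x * (η * cu / 4) := mul_le_mul_of_nonneg_left hzs hx0.le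
    have h1' : x * (η * cu / 4) ≤ x * (η * 1 / 4) := by gcongr
    have h2 : η / 4 * x * (c₁ * Q ^ (-(2 : ℝ))) ≤ η / 4 * x * 1 :=
      mul_le_mul_of_nonneg_left ((mul_le_mul hc₁1 hQm2 hQm2'.le zero_le_one).trans (by norm_num)) (by positivity)
    have hηx : 0 < η * x := mul_pos hη hx0
    linarith
  · -- (B) an exceptional zero `β₁` of `ζ₁_N`: real, unique, simple
    have hZ₁ : (((1 : ClassGroup (𝓞 N) →* ℂˣ) = 1 → dedekindZeta₁ N β₁ = 0) ∧
        ((1 : ClassGroup (𝓞 N) →* ℂˣ) ≠ 1 → classGroupLFunction₀ N 1 β₁ = 0)) ∧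
        1 - c₀ / (Real.log ((NumberField.discr N).natAbs : ℝ) + Real.log (|(β₁ : ℂ).im| + 4)) < (β₁ : ℂ).re := by
      refine ⟨⟨fun _ ↦ hζβ, fun h ↦ absurd rfl h⟩, lpRegion_mono hcc₀ ?_⟩
      rw [Complex.ofReal_im, abs_zero, zero_add, Complex.ofReal_re]; exact hβwin
    have hexcβ : excRegion c N (β₁ : ℂ) := ⟨Complex.ofReal_im β₁, by rw [Complex.ofReal_re]; exact hβwin⟩
    have hmult : analyticOrderNatAt (dedekindZeta₁ N) β₁ = 1 := by
      obtain ⟨hs1, -⟩ := hLPsimple 1 (β₁ : ℂ) hZ₁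
      have h := hs1 rfl
      have hne : analyticOrderAt (dedekindZeta₁ N) β₁ ≠ ⊤ := by rw [h]; exact ENat.one_ne_top
      have : (analyticOrderNatAt (dedekindZeta₁ N) β₁ : ℕ∞) = 1 := by rw [Nat.cast_analyticOrderNatAt hne, h]
      exact_mod_cast this
    have hβhalf : 1 / 2 ≤ β₁ := by
      have hlog4 : 1 < Real.log 4 := by
        rw [show (4:ℝ) = 2 ^ 2 by norm_num, Real.log_pow]; have := Real.log_two_gt_d9; push_cast; linarith
      have hc2 : c ≤ 1 / 2 :=
        hcn.trans (by rw [div_le_div_iff_of_pos_left one_pos (by positivity) (by norm_num)]; nlinarith)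
      have hlogd : 0 ≤ Real.log ((NumberField.discr N).natAbs : ℝ) := Real.log_natCast_nonneg _
      have : c / (Real.log ((NumberField.discr N).natAbs : ℝ) + Real.log 4) ≤ 1 / 2 := by
        rw [div_le_iff₀ (by linarith)]; nlinarith
      linarith
    have hβ0 : 0 < β₁ := by linarith
    have hβ1ne : ((β₁ : ℝ) : ℂ) ≠ 1 := by
      intro h'; apply hβ1.ne; exact_mod_cast h'
    have hLzero : classGroupLFunction N 1 β₁ = 0 := by
      have := classGroupLFunction_eq_zero_of_famF (K := N) 0 (ρ := (β₁ : ℂ)) (by rw [famF_zero]; exact hζβ) hβ1ne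
      rwa [toHomUnits_toMulHom_zero] at this
    have h11 : (1 : ClassGroup (𝓞 N) →* ℂˣ) * 1 = 1 := by ext; simp
    have hδlow : c₁ * Q ^ (-(2 : ℝ)) ≤ 1 - β₁ := heff N hNn 1 h11 β₁ hβ1 hLzero
    have hrep := hDH' N 1 h11 β₁ hβ0 hβ1 hLzero
    -- the index `j₀` carrying `β₁`: `1 = ord_E + Σ_{0<j<m} ord_{L_j}` at `β₁`
    have hsum1 : analyticOrderNatAt (dedekindZeta₁ E) β₁ + ∑ j ∈ Finset.Ico 1 m, analyticOrderNatAt (L j) β₁ = 1 := by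
      rw [← hord]; exact hmult
    -- the exceptional sets
    set Exc : ℕ → Finset ℂ := fun j ↦
      if j = 0 then (if dedekindZeta₁ E β₁ = 0 then {(β₁ : ℂ)} else ∅)
      else (if L j β₁ = 0 then {(β₁ : ℂ)} else ∅) with hExcdef
    have hExc0 : ∀ ρ ∈ Exc 0, famF E 0 ρ = 0 ∧ 0 < ρ.re ∧ ρ.re < 1 := by
      intro ρ hρ
      rw [hExcdef] at hρ; dsimp only at hρ; rw [if_pos rfl] at hρ
      split_ifs at hρ with h0
      · rw [Finset.mem_singleton] at hρ; subst hρ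
        exact ⟨by rw [famF_zero]; exact h0, by rw [Complex.ofReal_re]; exact hβ0, by rw [Complex.ofReal_re]; exact hβ1⟩
      · simp at hρ
    have hExcj : ∀ j ∈ Finset.Ico 1 m, ∀ ρ ∈ Exc j, L j ρ = 0 ∧ 0 < ρ.re ∧ ρ.re < 1 := by
      intro j hj ρ hρ
      have hj0 : j ≠ 0 := by rw [Finset.mem_Ico] at hj; omega
      rw [hExcdef] at hρ; dsimp only at hρ; rw [if_neg hj0] at hρ
      split_ifs at hρ with h0
      · rw [Finset.mem_singleton] at hρ; subst hρ
        exact ⟨h0, by rw [Complex.ofReal_re]; exact hβ0, by rw [Complex.ofReal_re]; exact hβ1⟩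
      · simp at hρ
    have hExc' : ∀ ρ, dedekindZeta₁ N ρ = 0 → 0 < ρ.re → ρ.re < 1 → excRegion c N ρ →
        (famF E 0 ρ = 0 → ρ ∈ Exc 0) ∧ ∀ j ∈ Finset.Ico 1 m, L j ρ = 0 → ρ ∈ Exc j := by
      intro ρ h0 _ _ hexc
      obtain ⟨-, hρρ⟩ := hLPuniq 1 1 ρ (β₁ : ℂ) (hexcZ ρ h0 hexc) hZ₁
      subst hρρ
      refine ⟨fun hE0 ↦ ?_, fun j hj hj0 ↦ ?_⟩
      · rw [famF_zero] at hE0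
        rw [hExcdef]; dsimp only; rw [if_pos rfl, if_pos hE0, Finset.mem_singleton]
      · have hjne : j ≠ 0 := by rw [Finset.mem_Ico] at hj; omega
        rw [hExcdef]; dsimp only; rw [if_neg hjne, if_pos hj0, Finset.mem_singleton]
    -- the correction term is `(Σ_j c^j ord_j(β₁)) F(−β₁)`
    have hcorr : ∀ (cc : ℂ) (gg : ℝ → ℝ),
        ∑ ρ ∈ Exc 0, (famMult E 0 ρ : ℂ) * fordLaplace gg (-ρ) +
          ∑ j ∈ Finset.Ico 1 m, cc ^ j * ∑ ρ ∈ Exc j, (analyticOrderNatAt (L j) ρ : ℂ) * fordLaplace gg (-ρ) =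
        ((analyticOrderNatAt (dedekindZeta₁ E) β₁ : ℂ) +
          ∑ j ∈ Finset.Ico 1 m, cc ^ j * (analyticOrderNatAt (L j) β₁ : ℂ)) * fordLaplace gg (-(β₁ : ℂ)) := by
      intro cc gg
      have h0 : ∑ ρ ∈ Exc 0, (famMult E 0 ρ : ℂ) * fordLaplace gg (-ρ) =
          (analyticOrderNatAt (dedekindZeta₁ E) β₁ : ℂ) * fordLaplace gg (-(β₁ : ℂ)) := by
        rw [hExcdef]; dsimp only; rw [if_pos rfl]; simp only [famMult, famF_zero]
        exact sum_excSingleton_eq (dedekindZeta₁_differentiable E) (β₁ : ℂ) (fun ρ ↦ fordLaplace gg (-ρ))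
      have hj : ∀ j ∈ Finset.Ico 1 m, ∑ ρ ∈ Exc j, (analyticOrderNatAt (L j) ρ : ℂ) * fordLaplace gg (-ρ) =
          (analyticOrderNatAt (L j) β₁ : ℂ) * fordLaplace gg (-(β₁ : ℂ)) := by
        intro j hj
        have hjne : j ≠ 0 := by rw [Finset.mem_Ico] at hj; omega
        rw [hExcdef]; dsimp only; rw [if_neg hjne]
        exact sum_excSingleton_eq (hL j hj).1 (β₁ : ℂ) (fun ρ ↦ fordLaplace gg (-ρ))
      rw [h0, Finset.sum_congr rfl (fun j hj' ↦ by rw [hj j hj']), add_mul, Finset.sum_mul]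
      refine congrArg _ (Finset.sum_congr rfl fun j _ ↦ by ring)
    obtain ⟨j₀, hj₀m, hj₀carrier, hθ⟩ := exists_carrier_index (o := fun j ↦ analyticOrderNatAt (L j) β₁) hm1 hsum1
    refine ⟨j₀, hj₀m, hj₀carrier, fun cc hcc x hx ↦ ?_⟩
    have hxQ : Q ≤ x := by
      have : Q ^ (1 : ℝ) ≤ Q ^ a₁ := Real.rpow_le_rpow_of_exponent_le hQ1.le ha₁1
      rw [Real.rpow_one] at this; linarith
    have hx0 : 0 < x := by linarith
    have hLQ : a₁ * Real.log Q ≤ Real.log x := by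
      have := Real.log_le_log (by positivity) hx
      rwa [Real.log_rpow (by linarith)] at this
    have hL2a : 2 * a₁ ≤ Real.log x := by nlinarith
    have hL64 : 64 ≤ Real.log x := by nlinarith
    have hL1 : 1 ≤ Real.log x := by linarith
    have hL0 : 0 < Real.log x := by linarith
    have hδ₁0 : 0 < 1 - β₁ := by linarith
    have hη₁0 : 0 < (1 - β₁) * Real.log x := mul_pos hδ₁0 hL0
    have hδη : 1 - β₁ ≤ (1 - β₁) * Real.log x := by
      have := mul_le_mul_of_nonneg_left hL1 hδ₁0.le; rw [mul_one] at this; exact this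
    have hη₁low : c₁ * Q ^ (-(2 : ℝ)) ≤ (1 - β₁) * Real.log x := hδlow.trans hδη
    have hη₁low1 : c₁ * Q ^ (-(2 : ℝ)) ≤ 1 := (mul_le_mul hc₁1 hQm2 hQm2'.le zero_le_one).trans (by norm_num)
    have hη₁m : c₁ * Q ^ (-(2 : ℝ)) ≤ min 1 ((1 - β₁) * Real.log x) := le_min hη₁low1 hη₁low
    have hm0' : 0 ≤ min 1 ((1 - β₁) * Real.log x) := le_min zero_le_one hη₁0.le
    have hηxm : 0 ≤ η * x * min 1 ((1 - β₁) * Real.log x) := by positivity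
    -- the correction term at this `x`
    have hcorr' : ∑ ρ ∈ Exc 0, (famMult E 0 ρ : ℂ) * fordLaplace (tzTest (Real.log x) (x ^ (-ν))) (-ρ) +
        ∑ j ∈ Finset.Ico 1 m, cc ^ j *
          ∑ ρ ∈ Exc j, (analyticOrderNatAt (L j) ρ : ℂ) * fordLaplace (tzTest (Real.log x) (x ^ (-ν))) (-ρ) =
        cc ^ j₀ * fordLaplace (tzTest (Real.log x) (x ^ (-ν))) (-(β₁ : ℂ)) := by
      rw [hcorr cc, hθ cc]
    rcases le_or_gt cu ((1 - β₁) * Real.log x) with hA | hB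
    · -- regime A: the classical zero-free region suffices
      have key := hcore x hx cc hcc Exc hExc0 hExcj hExc' c hc (hzfr_c x)
      rw [hcorr'] at key
      have hmcu : cu ≤ min 1 ((1 - β₁) * Real.log x) := le_min hcu1 hA
      have heΛ : Real.exp (-Λ) ≤ η * cu / (8 * A₁) := by
        refine exp_neg_le_of_neg_log_le (by positivity) ?_
        rw [← Real.log_inv, inv_div]; exact le_max_right _ _
      have hzs := zeroSum_main_small (η := η * cu) hc ha hA₁0 hΛ0 hlogQ0 hL0 hLQ hL2a ha₁i ha₁i' heΛ
      have h1 : x * (A₁ * (Real.exp (-(c * Real.log x / (4 * a * Real.log Q))) +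
          Real.exp (-Real.sqrt (c * Real.log x / 4)))) ≤ η / 4 * x * min 1 ((1 - β₁) * Real.log x) := by
        calc x * (A₁ * (Real.exp (-(c * Real.log x / (4 * a * Real.log Q))) +
            Real.exp (-Real.sqrt (c * Real.log x / 4))))
            ≤ x * (η * cu / 4) := mul_le_mul_of_nonneg_left hzs hx0.le
          _ = η / 4 * x * cu := by ring
          _ ≤ η / 4 * x * min 1 ((1 - β₁) * Real.log x) := mul_le_mul_of_nonneg_left hmcu (by positivity)
      have h2 : η / 4 * x * (c₁ * Q ^ (-(2 : ℝ))) ≤ η / 4 * x * min 1 ((1 - β₁) * Real.log x) :=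
        mul_le_mul_of_nonneg_left hη₁m (by positivity)
      linarith [key, h1, h2, hηxm]
    · -- regime B: Deuring–Heilbronn
      have hη₁1 : (1 - β₁) * Real.log x ≤ 1 := hB.le.trans hcu1
      have hmin : min 1 ((1 - β₁) * Real.log x) = (1 - β₁) * Real.log x := min_eq_right hη₁1
      have hsmall : 2 * C * n₀ * ((1 - β₁) * Real.log x) ≤ 1 / 3 := by
        have h1 : 2 * C * n₀ * ((1 - β₁) * Real.log x) ≤ 2 * C * n₀ * cu :=
          mul_le_mul_of_nonneg_left hB.le (by positivity)
        have h2 : 2 * C * n₀ * cu ≤ 2 * C * n₀ * (1 / (6 * C * n₀)) :=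
          mul_le_mul_of_nonneg_left hcuC (by positivity)
        have h3 : 2 * C * n₀ * (1 / (6 * C * n₀)) = 1 / 3 := by field_simp; ring
        linarith
      have hη₁A : (1 - β₁) * Real.log x ≤ η / (32 * A₁ * C ^ 2 * n₀ ^ 2) := hB.le.trans hcuA
      have hL4 : 4 ≤ Real.log x := by linarith
      have hcZ0 : 0 < min (Real.log (1 / (2 * C * n₀ * ((1 - β₁) * Real.log x))) / (C * n₀))
          (a * Real.log Q / 2) := by
        refine lt_min (div_pos (Real.log_pos ?_) (by positivity)) (by positivity)
        have h0 : 0 < 2 * C * n₀ * ((1 - β₁) * Real.log x) := by positivity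
        rw [lt_div_iff₀ h0]; linarith
      have hzfr : ∀ (ψ : AddChar (Additive (ClassGroup (𝓞 N))) ℂ) (ρ : ℂ), famF N ψ ρ = 0 →
          1 / 4 ≤ ρ.re → ρ.re < 1 → |ρ.im| ≤ x → ¬ excRegion c N ρ →
            ρ.re ≤ 1 - min (Real.log (1 / (2 * C * n₀ * ((1 - β₁) * Real.log x))) / (C * n₀))
              (a * Real.log Q / 2) / (a * Real.log Q + Real.log (|ρ.im| + 4)) :=
        zfr_of_zeroRepulsion (K := N) hn₀ hNn hC (c := c) (a := a) ha hexcβ hβ1 hxQ hL4 hrep hsmall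
      have key := hcore x hx cc hcc Exc hExc0 hExcj hExc' _ hcZ0 hzfr
      rw [hcorr'] at key
      have hη₁low' : c₁ * Real.exp (-(2 * Real.log Q)) ≤ (1 - β₁) * Real.log x := by
        rw [← hQexp2]; exact hη₁low
      have hzs := dhRegime_zeroSum_small (A₀ := A₁) (C := C) (n := (n₀ : ℝ)) (η := η)
        (η₁ := (1 - β₁) * Real.log x) (c₁ := c₁) (a := a) (lQ := Real.log Q) (L := Real.log x) (a₁ := a₁)
        hA₁0 hC hn2 hη hc₁ ha (by linarith) hη₁0 hη₁low' hsmall hη₁A hLQ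
        (by rw [← hΛ₁]; exact ha₁1') (by rw [← hΛ₂]; exact ha₁2') (by rw [← hΛ₃]; exact ha₁3')
      have h1 : x * (A₁ * (Real.exp (-(min (Real.log (1 / (2 * C * n₀ * ((1 - β₁) * Real.log x))) / (C * n₀))
          (a * Real.log Q / 2) * Real.log x / (4 * a * Real.log Q))) +
          Real.exp (-Real.sqrt (min (Real.log (1 / (2 * C * n₀ * ((1 - β₁) * Real.log x))) / (C * n₀))
          (a * Real.log Q / 2) * Real.log x / 4)))) ≤ η / 4 * x * ((1 - β₁) * Real.log x) := by
        calc _ ≤ x * (η / 4 * ((1 - β₁) * Real.log x)) := mul_le_mul_of_nonneg_left hzs hx0.le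
          _ = η / 4 * x * ((1 - β₁) * Real.log x) := by ring
      have h2 : η / 4 * x * (c₁ * Q ^ (-(2 : ℝ))) ≤ η / 4 * x * ((1 - β₁) * Real.log x) :=
        mul_le_mul_of_nonneg_left hη₁low (by positivity)
      rw [hmin]
      have hpos : 0 ≤ η * x * ((1 - β₁) * Real.log x) := by positivity
      linarith [key, h1, h2, hpos]

end Summit.QuantumAdvantage.QuantumAdvantage.Theorems.DegreeOnePrimesEscape
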